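import Literature.Analysis.FluidPDE.FluidComputer.ThresholdLevelTableRunV0
import Literature.Analysis.FluidPDE.FluidComputer.ThresholdLevelTableRunV1
import Literature.Analysis.FluidPDE.FluidComputer.ThresholdLevelTableRunV2
import Literature.Analysis.FluidPDE.FluidComputer.ThresholdLevelTableRunV3
import Literature.Analysis.FluidPDE.FluidComputer.ThresholdLevelTableRunV4
import Literature.Analysis.FluidPDE.FluidComputer.ThresholdLevelTableRunV5
import Literature.Analysis.FluidPDE.FluidComputer.ThresholdLevelTableRunV6
import Literature.Analysis.FluidPDE.FluidComputer.ThresholdLevelTableRunV7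
import Literature.Analysis.FluidPDE.FluidComputer.ThresholdLevelCertificate
import HarnessLib

/-!
# Certificate: the transfer stage of the threshold gate, UNIFORMLY over a 3 % box in the timing-critical couplings (bp3 gen 13, layer 4: robustness variant V)

HONEST FRAMING: low prior, high value-of-information experiment on Tao's machine paradigm; NOT a
claim that NS blows up.

The design-point certificate `designPoint_transfer_reach` (`ThresholdLevelCertificate.lean`)
made uniform over the box `GIv`: trigger pump `ε`, trigger self-interaction `σ` and rotor rate
`r` — the three couplings that set the TIMING of the transfer — each within relative `3·10⁻²` of
the design values `ε₀ = 0.2`, `σ₀ ≈ 3.58·10⁻⁴`, `r₀ ≈ 1.1757·10⁴`; `ν = 480`, `μ = 96`,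
`κ = 4800` at the design values; any forcing defect `0 ≤ δ ≤ δ₀ ≈ 3.58·10⁻⁶`.  For EVERY such
gate datum, every `δ`-approximate orbit of `thresholdCircuit ε σ ν μ r κ` started in the SAME
level-`0` entry box (`Bc0`), continuous on `[0, T₃]`, `T₃ = T₃t ≈ 0.20705`, satisfies
`x s 4 ^ 2 ≥ EoutV = (1097740459070805103/2^60)² ≈ 0.90657` at some `s ∈ [0, T₃]`
(`dataBoxV_transfer_reach`) — at least `90.60 %` of the entry energy in the output mode, with the
levels and caps of the design-point table UNCHANGED (a re-tuned table per datum would do better; this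
is the margin of one fixed certificate).  Same proof as the design point: kernel runs
`runV0 … runV31` (`ThresholdLevelTableRunV0 … 7`), `runSteps_append_some`,
`TableD.rowsValid_of_runSteps`, `levelTableStage_reach`.  Sorry-free; standard axioms only.
(Measured by compiled evaluation, not a theorem: the same widening at `10⁻¹` fails at step 357.)

WHAT THIS IS NOT: stage 3 only, of one gate of the `5`-mode truncated circuit with an abstract
forcing defect; a constant robustness margin in three of six couplings; not the gate verdict, not
a statement about the averaged or true equations, not evidence for blow-up.
-/

noncomputable section

open Set

namespace Literature.Analysis.FluidPDE.FluidComputer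

open Literature.Analysis.FluidPDE.Tao2016AveragedNS

namespace ThresholdLevelTable

/-- The whole box-`V` table run. [folklore] -/
theorem runV_all : runSteps 60 12 3 GIv RbIt Bc0 stepsT CNt = some Bv32 :=
  runSteps_append_some 60 12 3 GIv RbIt runV0
    (runSteps_append_some 60 12 3 GIv RbIt runV1
    (runSteps_append_some 60 12 3 GIv RbIt runV2
    (runSteps_append_some 60 12 3 GIv RbIt runV3
    (runSteps_append_some 60 12 3 GIv RbIt runV4
    (runSteps_append_some 60 12 3 GIv RbIt runV5
    (runSteps_append_some 60 12 3 GIv RbIt runV6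
    (runSteps_append_some 60 12 3 GIv RbIt runV7
    (runSteps_append_some 60 12 3 GIv RbIt runV8
    (runSteps_append_some 60 12 3 GIv RbIt runV9
    (runSteps_append_some 60 12 3 GIv RbIt runV10
    (runSteps_append_some 60 12 3 GIv RbIt runV11
    (runSteps_append_some 60 12 3 GIv RbIt runV12
    (runSteps_append_some 60 12 3 GIv RbIt runV13
    (runSteps_append_some 60 12 3 GIv RbIt runV14
    (runSteps_append_some 60 12 3 GIv RbIt runV15
    (runSteps_append_some 60 12 3 GIv RbIt runV16
    (runSteps_append_some 60 12 3 GIv RbIt runV17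
    (runSteps_append_some 60 12 3 GIv RbIt runV18
    (runSteps_append_some 60 12 3 GIv RbIt runV19
    (runSteps_append_some 60 12 3 GIv RbIt runV20
    (runSteps_append_some 60 12 3 GIv RbIt runV21
    (runSteps_append_some 60 12 3 GIv RbIt runV22
    (runSteps_append_some 60 12 3 GIv RbIt runV23
    (runSteps_append_some 60 12 3 GIv RbIt runV24
    (runSteps_append_some 60 12 3 GIv RbIt runV25
    (runSteps_append_some 60 12 3 GIv RbIt runV26
    (runSteps_append_some 60 12 3 GIv RbIt runV27
    (runSteps_append_some 60 12 3 GIv RbIt runV28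
    (runSteps_append_some 60 12 3 GIv RbIt runV29
    (runSteps_append_some 60 12 3 GIv RbIt runV30
    (runV31)))))))))))))))))))))))))))))))

/-- The certified output load on the data box, `(zℓ at level 800)² ≈ 0.90657`. [folklore] -/
def EoutV : ℝ := ((1097740459070805103 : ℝ) / 2 ^ 60) ^ 2

/-- Gate data in the box `V` are admissible (signs). [folklore] -/
theorem valid_of_memV {G : GateData} (hG : GIv.Mem 60 G) : G.Valid :=
  ⟨DI.nonneg_of_nonnegB (I := GIv.ε) (by decide) hG.ε,
    DI.nonneg_of_nonnegB (I := GIv.σ) (by decide) hG.σ,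
    DI.nonneg_of_nonnegB (I := GIv.ν) (by decide) hG.ν,
    DI.nonneg_of_nonnegB (I := GIv.μ) (by decide) hG.μ,
    DI.nonneg_of_nonnegB (I := GIv.r) (by decide) hG.r,
    DI.pos_of_posB (I := GIv.κ) (by decide) hG.κ,
    DI.nonneg_of_nonnegB (I := GIv.δ) (by decide) hG.δ⟩

/-- The real level table generated for the box `V`. [folklore] -/
def LtV : LevelTable := tableT.toTable 60 12 3 GIv RbIt

/-- Its rows are valid for every gate datum in the box, and the final entry box is `Bv32`.
[folklore] -/
theorem LtV_rowsValid {G : GateData} (hG : GIv.Mem 60 G) :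
    LtV.RowsValid G Rbt ∧ tableT.entry 60 12 3 GIv RbIt tableT.steps.length = Bv32 :=
  TableD.rowsValid_of_runSteps (by norm_num) hG RbIt_mem tableT runV_all

/-- The caps of `LtV` sum to `T₃t` (same steps as `Lt`). [folklore] -/
theorem LtV_time : ∑ k ∈ Finset.range LtV.N, LtV.h k = T₃t := Lt_time

/-- The level-`0` entry box and level are those of the design-point table. [folklore] -/
theorem LtV_B_zero : LtV.B 0 = Lt.B 0 ∧ LtV.C 0 = Lt.C 0 := ⟨rfl, rfl⟩

/-- Energy confinement margin, uniformly in `δ ≤ δ₀`. [folklore] -/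
theorem LtV_energy {G : GateData} (hG : GIv.Mem 60 G) :
    ∀ q ∈ {q | (LtV.B 0).mem G.κ G.r (LtV.C 0) q}, energy q + 10 * (G.δ * Rbt) * T₃t < Rbt ^ 2 := by
  intro q hq
  have hEh : energy q ≤ ((1153613361157173206 : ℤ) : ℝ) / 2 ^ 60 := hq.2.2.2.2.2.2
  have hδ : G.δ * 2 ^ 60 ≤ ((4124823204108 : ℤ) : ℝ) := hG.δ.2
  have hnum : ((1153613361157173206 : ℤ) : ℝ) / 2 ^ 60 +
      10 * ((((4124823204108 : ℤ) : ℝ) / 2 ^ 60) * Rbt) * T₃t < Rbt ^ 2 := by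
    norm_num [Rbt, T₃t]
  have hRb : (0 : ℝ) < Rbt := by norm_num [Rbt]
  have hT : (0 : ℝ) < T₃t := by norm_num [T₃t]
  have hδ' : G.δ ≤ ((4124823204108 : ℤ) : ℝ) / 2 ^ 60 := by
    rw [le_div_iff₀ (by positivity)]; exact hδ
  have hmono : 10 * (G.δ * Rbt) * T₃t ≤ 10 * ((((4124823204108 : ℤ) : ℝ) / 2 ^ 60) * Rbt) * T₃t := by
    have := mul_le_mul_of_nonneg_right hδ' hRb.le
    nlinarith
  linarith

/-- The final entry box certifies the output load. [folklore] -/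
theorem LtV_exit {G : GateData} (hG : GIv.Mem 60 G) :
    ∀ X, (LtV.B LtV.N).mem G.κ G.r (LtV.C LtV.N) X → EoutV ≤ X 4 ^ 2 := by
  intro X hX
  have hB : LtV.B LtV.N = Bv32.toReal 60 := by
    show (tableT.entry 60 12 3 GIv RbIt tableT.steps.length).toReal 60 = _
    rw [(LtV_rowsValid hG).2]
  rw [hB] at hX
  have hz : ((1097740459070805103 : ℤ) : ℝ) / 2 ^ 60 ≤ X 4 := hX.2.2.2.2.1.1
  have h0 : (0 : ℝ) ≤ ((1097740459070805103 : ℤ) : ℝ) / 2 ^ 60 := by positivity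
  calc EoutV = (((1097740459070805103 : ℤ) : ℝ) / 2 ^ 60) ^ 2 := by norm_num [EoutV]
    _ ≤ X 4 ^ 2 := pow_le_pow_left₀ h0 hz 2

/-- The stage-3 reach certificate of the assembly interface, for every gate datum in the box `V`.
[folklore] -/
def dataBoxV_transferStage {G : GateData} (hG : GIv.Mem 60 G) :
    ReachCertificate (thresholdCircuit G.ε G.σ G.ν G.μ G.r G.κ) (modeBall Rbt) G.δ T₃t
      {q | (LtV.B 0).mem G.κ G.r (LtV.C 0) q} (outputLoaded EoutV) :=
  levelTableStage G (valid_of_memV hG) Rbt T₃t EoutV LtV _ (by norm_num [Rbt]) (LtV_rowsValid hG).1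
    LtV_time.le (LtV_energy hG) (fun _ hq => hq) (LtV_exit hG)

/-- THE UNIFORM CERTIFICATE ON THE BOX `V`.  For every gate datum `G` in `GIv` (`ε, σ, r`
within relative `3·10⁻²` of the design point, `ν, μ, κ` at the design values, `0 ≤ δ ≤ δ₀`),
every `G.δ`-approximate orbit of the threshold circuit started in the level-`0` entry box loads
the output mode to `x s 4 ^ 2 ≥ EoutV ≈ 0.90657` at some time `s ≤ T₃t ≈ 0.20705`.
[cite: Tao2016AveragedNS, §5.5 Thm 5.3 (5.5)] -/
theorem dataBoxV_transfer_reach {G : GateData} (hG : GIv.Mem 60 G) {p : Fin 5 → ℝ}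
    (hp : (LtV.B 0).mem G.κ G.r (LtV.C 0) p) {x : ℝ → Fin 5 → ℝ} (hx0 : x 0 = p)
    (hcont : ContinuousOn x (Icc 0 T₃t))
    (hder : ∀ s ∈ Ico 0 T₃t, ∃ W : Fin 5 → ℝ, HasDerivWithinAt x W (Ici s) s ∧
      ‖W - thresholdCircuit G.ε G.σ G.ν G.μ G.r G.κ (x s)‖ ≤ G.δ) :
    ∃ s ∈ Icc 0 T₃t, EoutV ≤ x s 4 ^ 2 :=
  levelTableStage_reach G (valid_of_memV hG) Rbt T₃t EoutV LtV
    {q | (LtV.B 0).mem G.κ G.r (LtV.C 0) q} (by norm_num [Rbt]) (LtV_rowsValid hG).1 LtV_time.le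
    (by norm_num [T₃t]) (LtV_energy hG) (fun _ hq => hq) (LtV_exit hG) hp hx0 hcont hder

/-- The design point itself lies in the box `V`. [folklore] -/
theorem Gt_memV : GIv.Mem 60 Gt :=
  ⟨by norm_num [DI.mem, GIv, Gt], by norm_num [DI.mem, GIv, Gt], by norm_num [DI.mem, GIv, Gt],
    by norm_num [DI.mem, GIv, Gt], by norm_num [DI.mem, GIv, Gt], by norm_num [DI.mem, GIv, Gt],
    by norm_num [DI.mem, GIv, Gt]⟩

end ThresholdLevelTable

end Literature.Analysis.FluidPDE.FluidComputer

end
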